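/-
Copyright (c) 2026 the pub-hodgecm-mathlib formalisation cell (harness21).  Prover seat hodgecm-mathlib-K2Liu-p09 (g3): Track B «K2-LIT», #184♮ = hLiu418,
payer-internal organ O2 «θ-TYPE EIGENVALUES ON THE DIAGONAL SIDE» of file #34 `Theorems/K2LiuDoublingZetaGL1.lean` (LEAD F0P6-plan (g10) DEAL
K2/STATUS 2026-09-04T02:36:29Z; REPORT-FIRST #34 v3, K2/K2Liu-p09/g3; FINDING (G) of DEPMAP v2.5 §10).
-/
import Summits.HodgeConjecture.HodgeConjecture.Theorems.K2LiuThetaTypeSphericalEigenvaluesSplit   -- ★ #30a p856760 (K2Liu-p01 g3)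
import Literature.NumberTheory.Automorphic.UnitaryGroupFormCongrFinSum                            -- ★ `formCongr_one_eq`
import Literature.NumberTheory.Automorphic.UnitaryGroupLevelTransport                             -- ★ `finAdelicCongr`
import HarnessLib

/-!
# Crux `HLiu418`, Track B road `K2_Liu`, file #34 — organ O2 «★ #30a READ ON THE DIAGONAL SIDE: NO HERMITIAN HYPOTHESIS ON `H`»

Cell `hodgecm-mathlib`, crux item hLiu418 = `stmt-HodgeConjecture-24832`, route of record `HCCMUnconditional`; squad K2 ∕ K2Liu, prover K2Liu-p09 (g3).
THEOREMS ONLY (no `def`, no instance, no notation, no named-fact hypothesis, no `sorry`, default heartbeats); lane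
`--supports stmt-HodgeConjecture-24832 --as helper` (count-neutral).

FINDING (G) (DEPMAP v2.5 §10, typist g2; ref1, p01, A-plan2 m42): ★ #30a `thetaTypeSphericalEigenvaluesSplit` binds `hH : (H.map c)ᵀ = H`
on top of s23's frame, and s23 (`t : L`, no reality clause) cannot supply it when `c t ≠ t`.  RESOLUTION USED BY THE PAYER (this file, a
variant of road (G1)∕(R2): no frozen byte touched, no new socket, no `t • H`): read ★ #30a at the frame `(H, t, g) := (diagonal dV, 1, 1)`,
where `hg` is ★ `formCongr_one_eq` and `hH` is the diagonal's own `transpose_map_diagonal`, for the TRANSPORTED representation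
`σ' := σ ∘ finAdelicCongr g : U(diag dV)(𝔸_f) → GL(W)` (★ `finAdelicCongr g ht hg : U(diag dV)(𝔸_f) ≃ U(H)(𝔸_f)`, `x ↦ g x g⁻¹`), whose
intertwiner into `ω⋆ ∘ (finAdelicCongr 1)⁻¹ = ω⋆` is s23's `j` itself (`(finAdelicCongr g)⁻¹ ∘ finAdelicCongr g = id`,
`(finAdelicCongr 1)⁻¹ = id` on values).  OUTPUT `thetaTypeSphericalEigenvaluesSplit_diag`: ★ #30a's two eigen-equations for
`T_{w,1}, T_{w,2}` of `U(diag dV)` on `σ'^{K'}`, `K'` hyperspecial at `v`, at every split good `w ∉ S₀` — i.e. ON THE SIDE WHERE ★ #28s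
`unramifiedDoublingHeckeIdentity` LIVES, with ITS generators `e_w⁻¹(diag(ϖ,1))`, `e_w⁻¹(diag(ϖ,ϖ))` (★ `heckeElementAt` = `inclPlace v ∘ e_w⁻¹ ∘ heckeDiag`);
the bridge O3 moves them to s23's `P` on `U(H)` along `finAdelicCongr g` (★ `evalPlace_finAdelicCongr`) and back along `localCongr` for ★ #28s.

HONEST LABEL: HC_CM is proved only modulo the printed citations (2 remaining named inputs: hLiu418 = stmt-HodgeConjecture-24832,
h413 = stmt-HodgeConjecture-24833) until rung 0 closes; this file is bookkeeping toward socket s23 and closes no item.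
References: [Liu2021] App. D, proof of Lem. D.1 (p. 126), Lem. D.1 (2)–(4); [GelbartRogawski1991] §3.2 p. 457; [PlatonovRapinchuk1994] §2.3;
[CartierCorvallis1979] §IV.2 (4.2).
-/

set_option autoImplicit false
set_option linter.dupNamespace false

noncomputable section

open NumberField MeasureTheory IsDedekindDomain
open scoped Matrix
open Literature.NumberTheory.Automorphic Literature.NumberTheory.Automorphic.UnitaryGroup
open Literature.NumberTheory.Automorphic.IdeleClassGroup
open Literature.NumberTheory.Automorphic.Liu2021
open Literature.NumberTheory.Automorphic.Liu2021.Def411WeilCarriers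
open Literature.NumberTheory.Automorphic.Liu2021.Def411WeilCarriersDoubling
open Literature.NumberTheory.GaloisRepresentations
open Literature.NumberTheory.GelbartRogawski1991 Literature.NumberTheory.GelbartRogawski1991.UnitaryDualPair
open Literature.NumberTheory.Weil1964
open Literature.RepresentationTheory.Liu2021 Literature.RepresentationTheory.HarrisKudlaSweet1996
open Summit.HodgeConjecture.HodgeConjecture.Cruxes.HLiu418.K2LiuThetaTypeSphericalEigenvaluesSplit (thetaTypeSphericalEigenvaluesSplit)

namespace Summit.HodgeConjecture.HodgeConjecture.Cruxes.HLiu418.K2LiuDoublingZetaGL1ThetaEigenDiag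

/-! ## §1 `finAdelicCongr 1` and `(finAdelicCongr g)⁻¹ ∘ finAdelicCongr g` are the identity on values -/

section Congr

variable {F E : Type} [Field F] [NumberField F] [Field E] [NumberField E] [Algebra F E]
  (c : E ≃ₐ[F] E) {N : ℕ}

omit [NumberField F] in
/-- `finAdelicCongr 1` (the congruence by the identity frame) is the identity map: `1_f x 1_f⁻¹ = x`. [cite: PlatonovRapinchuk1994, §2.3] -/
theorem finAdelicCongr_one_symm_apply {a : E} (ha : a ≠ 0) {J J' : Matrix (Fin N) (Fin N) E}
    (h : formCongr (c : E →+* E) (1 : GL (Fin N) E) (a • J) = J') (x : finAdelic F E c N J) :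
    (((finAdelicCongr F E c 1 ha h).symm x : finAdelic F E c N J') : GL (Fin N) (FiniteAdeleRing (𝓞 E) E)) =
      (x : GL (Fin N) (FiniteAdeleRing (𝓞 E) E)) := by
  rw [coe_finAdelicCongr_symm_apply, map_one, inv_one, one_mul, mul_one]


omit [NumberField F] in
/-- **Transport of an intertwiner along `finAdelicCongr`**: if `j : σ → ρ ∘ (finAdelicCongr B)⁻¹` intertwines (`σ` on `U(J)(𝔸_f)`, `ρ` on `U(J')(𝔸_f)`,
`ᵗ(cB)(a•J)B = J'`) and `σ'` is `σ ∘ finAdelicCongr B` on `U(J')(𝔸_f)`, then the SAME linear map intertwines `σ' → ρ ∘ (finAdelicCongr 1)⁻¹` (`= ρ`);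
injectivity is preserved. [cite: PlatonovRapinchuk1994, §2.3] -/
theorem exists_intertwiningMap_comp_finAdelicCongr {a : E} (ha : a ≠ 0) {J J' : Matrix (Fin N) (Fin N) E} (B : GL (Fin N) E)
    (h : formCongr (c : E →+* E) B (a • J) = J') {b : E} (hb : b ≠ 0) (h₁ : formCongr (c : E →+* E) (1 : GL (Fin N) E) (b • J') = J')
    {V W : Type} [AddCommGroup V] [Module ℂ V] [AddCommGroup W] [Module ℂ W]
    {ρ : Representation ℂ (finAdelic F E c N J') V} {σ : Representation ℂ (finAdelic F E c N J) W}
    (j : σ.IntertwiningMap (ρ.comp (finAdelicCongr F E c B ha h).symm.toMonoidHom)) (hj : Function.Injective j)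
    (σ' : Representation ℂ (finAdelic F E c N J') W) (hσ' : ∀ x, σ' x = σ (finAdelicCongr F E c B ha h x)) :
    ∃ j' : σ'.IntertwiningMap (ρ.comp (finAdelicCongr F E c 1 hb h₁).symm.toMonoidHom), Function.Injective j' := by
  set ρ₁ : Representation ℂ (finAdelic F E c N J') V := ρ.comp (finAdelicCongr F E c 1 hb h₁).symm.toMonoidHom with hρ₁def
  have hjσ : ∀ (x : finAdelic F E c N J) (v : W), j (σ x v) = (ρ.comp (finAdelicCongr F E c B ha h).symm.toMonoidHom) x (j v) :=
    fun x v => Representation.IntertwiningMap.isIntertwining _ _ j x v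
  have hj' : ∀ (x : finAdelic F E c N J') (v : W), j.toLinearMap (σ' x v) = ρ₁ x (j.toLinearMap v) := by
    intro x v
    have h4 : ρ₁ x = ρ ((finAdelicCongr F E c 1 hb h₁).symm.toMonoidHom x) := rfl
    rw [Representation.IntertwiningMap.coe_toLinearMap, hσ', hjσ, h4, MonoidHom.comp_apply]
    -- `(congr B)⁻¹ (congr B x) = x = (congr 1)⁻¹ x`
    have h2 : (finAdelicCongr F E c B ha h).symm.toMonoidHom (finAdelicCongr F E c B ha h x) = x := (finAdelicCongr F E c B ha h).symm_apply_apply x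
    have h3 : (finAdelicCongr F E c 1 hb h₁).symm.toMonoidHom x = x := Subtype.ext (finAdelicCongr_one_symm_apply c hb h₁ x)
    rw [h2, h3]
  exact ⟨LinearMap.intertwiningMap_of_isIntertwiningMap σ' ρ₁ j.toLinearMap hj', fun u v huv => hj huv⟩

end Congr

/-! ## §2 ★ #30a on the diagonal side -/

/-- **ORGAN O2 OF #34 — ★ #30a READ ON `U(diag dV)` FOR THE TRANSPORTED REPRESENTATION `σ ∘ finAdelicCongr g` (FINDING (G) DISSOLVED).**
In s23's frame (`H`, `dV`, `t ≠ 0`, `g`, `hg : ᵗ(cg)(t•H)g = diag dV`; `lam` conjugate symplectic, `a`, `χ`, a representation `σ` of `U(H)(𝔸_f)` with an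
INJECTIVE intertwiner `j : σ ↪ ω⋆ ∘ (finAdelicCongr g)⁻¹`) and for the diagonal form's own data (`hH' : (diag dV)ᶜᵀ = diag dV`, `hHu' : IsUnit (diag dV)`):
there is ONE finite `S₀` such that at every split `w ∉ S₀` with `(diag dV)_w ∈ GL₂(𝒪_w)`, every `K' ≤ U(diag dV)(𝔸_f)` hyperspecial at `v = w ∩ 𝓞L⁺`
and every `y ∈ (σ ∘ finAdelicCongr g)^{K'}`:
`T_{w,1} y = (λ^{alg}(ϖ_w) + ((λ^{alg})ᶜ·χ̌)(ϖ_w)) • y` and `N(w) • T_{w,2} y = (λ^{alg}(ϖ_w)·((λ^{alg})ᶜ·χ̌)(ϖ_w)) • y`, the operators being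
`heckeTAt … (diag dV) (σ ∘ finAdelicCongr g) K' w …` — ★ #30a at `(H, t, g) := (diag dV, 1, 1)` with the intertwiner `j` re-read for `σ ∘ finAdelicCongr g`.
[cite: Liu2021, App. D proof of Lemma D.1 first paragraph (p. 126); Lemma D.1 (2),(3),(4)] [cite: GelbartRogawski1991, §3.2 p. 457]
[cite: PlatonovRapinchuk1994, §2.3] [cite: CartierCorvallis1979, §IV.2 (4.2)] -/
theorem thetaTypeSphericalEigenvaluesSplit_diag :
    ∀ (L : Type) [Field L] [NumberField L] [IsCMField L] (H : Matrix (Fin 2) (Fin 2) L)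
      (dV : Fin 2 → L) (hdV : ∀ i, IsCMField.complexConj L (dV i) = dV i) (hdV0 : ∀ i, dV i ≠ 0)
      (t : L) (ht : t ≠ 0) (g : GL (Fin 2) L)
      (hg : formCongr ((IsCMField.complexConj L : L ≃ₐ[↥(maximalRealSubfield L)] L) : L →+* L) g (t • H) = Matrix.diagonal dV)
      (hH' : ((Matrix.diagonal dV).map (IsCMField.complexConj L))ᵀ = Matrix.diagonal dV) (hHu' : IsUnit (Matrix.diagonal dV))
      {n' : ℕ} (e₁ : Fin 2 × Fin 1 ≃ Fin n')
      (lam : Literature.NumberTheory.Automorphic.IdeleClassGroup L →ₜ* Circle) (hlam : IsConjugateSymplectic L lam)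
      (a : (↥(maximalRealSubfield L))ˣ) (χ : Chi (↥(maximalRealSubfield L)) L (IsCMField.complexConj L))
      (W : Type) [AddCommGroup W] [Module ℂ W]
      (σ : Representation ℂ (finAdelic (↥(maximalRealSubfield L)) L (IsCMField.complexConj L) 2 H) W)
      (j : σ.IntertwiningMap
        ((rhoVAtLine (↥(maximalRealSubfield L)) L (IsCMField.complexConj L) 2 e₁ (Matrix.diagonal dV)
            (complexConj_imagUnit L) (imagUnit_ne_zero L) (imagUnit_mul_self L) (realDiagonal_isSymm L dV hdV)
            (isUnit_det_realDiagonal L dV hdV hdV0) (realDiagonal_map L dV hdV).symm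
            (fun a => isCompatible_chiSplittingLine L e₁ dV hdV hdV0 (toHeckeCharacter L lam)
              (isUnitary_toHeckeCharacter L lam) ((isOscillatorChar_toHeckeCharacter_iff lam).mpr hlam)
              (TW (↥(maximalRealSubfield L)) a) (isSymm_TW (↥(maximalRealSubfield L)) a)
              (isUnit_det_TW (↥(maximalRealSubfield L)) a) (JW (↥(maximalRealSubfield L)) L a)
              (JW_eq (↥(maximalRealSubfield L)) L a)) a χ).comp
          (finAdelicCongr (↥(maximalRealSubfield L)) L (IsCMField.complexConj L) g ht hg).symm.toMonoidHom)),
      Function.Injective j →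
      -- the transported representation `σ' = σ ∘ finAdelicCongr g` on `U(diag dV)(𝔸_f)` (by value)
      ∀ (σ' : Representation ℂ (finAdelic (↥(maximalRealSubfield L)) L (IsCMField.complexConj L) 2 (Matrix.diagonal dV)) W),
      (∀ x, σ' x = σ (finAdelicCongr (↥(maximalRealSubfield L)) L (IsCMField.complexConj L) g ht hg x)) →
      ∃ S₀ : Set (HeightOneSpectrum (𝓞 L)), S₀.Finite ∧
        ∀ w : HeightOneSpectrum (𝓞 L), w ∉ S₀ → ∀ hw : (IsCMField.complexConj L) • w ≠ w,
          (UnitaryGroup.isUnit_placeForm (Matrix.diagonal dV) hHu' w).unit ∈ glInt 2 (w.adicCompletion L) →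
            ∀ K' : Subgroup ↥(finAdelic ↥(maximalRealSubfield L) L (IsCMField.complexConj L) 2 (Matrix.diagonal dV)),
              UnitaryGroup.IsHyperspecialAt ↥(maximalRealSubfield L) L (IsCMField.complexConj L) 2 (Matrix.diagonal dV) K'
                  (w.under (𝓞 ↥(maximalRealSubfield L))) →
              ∀ y ∈ σ'.fixedPoints K',
                UnitaryGroup.heckeTAt ↥(maximalRealSubfield L) L (IsCMField.complexConj L) 2 (Matrix.diagonal dV)
                    σ' K'
                    (⟨w, rfl⟩ : UnitaryGroup.PlacesOver L (w.under (𝓞 ↥(maximalRealSubfield L))))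
                    (IsCMField.complexConj_ne_one L) hH' hw (UnitaryGroup.isUnit_placeForm (Matrix.diagonal dV) hHu' w)
                    (HeckeCharacter.uniformizer L w) 1 y =
                  ((IdeleClassGroup.muAlg L lam).valueAtUniformizer w +
                    (HeckeCharacter.galConj (IsCMField.complexConj L) (IdeleClassGroup.muAlg L lam) *
                      HeckeCharacter.checkOfChi (complexConj_mul_complexConj' L) χ).valueAtUniformizer w) • y ∧
                (Ideal.absNorm w.asIdeal : ℂ) •
                  UnitaryGroup.heckeTAt ↥(maximalRealSubfield L) L (IsCMField.complexConj L) 2 (Matrix.diagonal dV)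
                    σ' K'
                    (⟨w, rfl⟩ : UnitaryGroup.PlacesOver L (w.under (𝓞 ↥(maximalRealSubfield L))))
                    (IsCMField.complexConj_ne_one L) hH' hw (UnitaryGroup.isUnit_placeForm (Matrix.diagonal dV) hHu' w)
                    (HeckeCharacter.uniformizer L w) 2 y =
                  ((IdeleClassGroup.muAlg L lam).valueAtUniformizer w *
                    (HeckeCharacter.galConj (IsCMField.complexConj L) (IdeleClassGroup.muAlg L lam) *
                      HeckeCharacter.checkOfChi (complexConj_mul_complexConj' L) χ).valueAtUniformizer w) • y := by
  intro L _ _ _ H dV hdV hdV0 t ht g hg hH' hHu' n' e₁ lam hlam a χ W _ _ σ j hj σ' hσ'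
  -- the frame `(diag dV, 1, 1)`: `ᵗ(c1)·(1 • diag dV)·1 = diag dV`
  have hg₁ : formCongr ((IsCMField.complexConj L : L ≃ₐ[↥(maximalRealSubfield L)] L) : L →+* L) (1 : GL (Fin 2) L)
      ((1 : L) • Matrix.diagonal dV) = Matrix.diagonal dV := by
    rw [one_smul]
    exact UnitaryGroup.formCongr_one_eq _ _
  -- `j` re-read as an intertwiner `σ' → ω⋆ ∘ (finAdelicCongr 1)⁻¹`
  obtain ⟨j', hj'⟩ := exists_intertwiningMap_comp_finAdelicCongr (IsCMField.complexConj L) ht g hg one_ne_zero hg₁ j hj σ' hσ'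
  -- ★ #30a at `(diag dV, 1, 1)` for `(σ', j')`
  exact thetaTypeSphericalEigenvaluesSplit L (Matrix.diagonal dV) dV hdV hdV0 1 one_ne_zero 1 hg₁ hH' hHu' e₁ lam hlam a χ W σ' j' hj'

end Summit.HodgeConjecture.HodgeConjecture.Cruxes.HLiu418.K2LiuDoublingZetaGL1ThetaEigenDiag

end
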